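import Literature.Probability.Percolation.FourArmGarbanMonotone
import HarnessLib

/-!
# The two-arm exponent of critical bond percolation on `ℤ²` is at most `1/3`
# (Duminil-Copin–Manolescu–Tassion 2021, §6.4, via Ikhlef–Ponsaing 2012)

Topic `Literature/Probability/Percolation`, bond percolation on the square lattice `ℤ² = Site 2`
at `p = 1/2` (`bondPercolation (zdGraph 2) half`), over the cluster-form two-arm event
`twoArmOpenDual m n` of `FourArmGarban.lean` (an open crossing of the square annulus
`A_{m,n} = {m ≤ ‖·‖_∞ ≤ n}` from `‖·‖_∞ = m` to `‖·‖_∞ = n` and no open circuit of `A_{m,n}`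
around the origin). One named fact, no definition; two proved corollaries (other inner radii,
big-O form).

Source. H. Duminil-Copin, I. Manolescu, V. Tassion, *Planar random-cluster model: fractal
properties of the critical phase*, Probab. Theory Related Fields 181 (2021) 401–449
(arXiv 2007.14707) [DuminilCopinManolescuTassion2021] (held text `paper:arxiv-2007.14707`,
chunks 20–21), §6.4 "New bounds on the one, two and four-arm exponents", verbatim:
"**Proposition 6.10.** Fix `1 ≤ q < 4`. There exists `c₁₄ > 0` such that
`φ_{ℤ²}[A_1(0,R)] ≥ c₁₄ π₁⁺(R)^{1/2}`, `φ_{ℤ²}[A_{10}(0,R)] ≥ c₁₄ π₁⁺(R)`,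
`φ_{ℤ²}[A_{1010}(1,R)] ≥ c₁₄ π₁⁺(R)/R`." (proof printed there: the second inequality by the
parafermionic contour identity on the Dobrushin domain `Λ_R` cut along the diagonal, the boundary
sum bound of Lemma 6.9, mixing and quasi-multiplicativity; the first from the second by FKG; the
third is Prop. 6.8 at `r = 1`), followed by: "This proposition implies that one deduces bounds on
the left-hand sides of the three inequalities from bounds on `π₁⁺(R)`. For `q = 1`, [PonIkh]
showed that `π₁⁺(R)R^{1/3}` is bounded away from `0` and `∞` uniformly in `R` so that
`φ_{ℤ²}[A_1(0,R)] ≥ c/R^{1/6}`, `φ_{ℤ²}[A_{10}(0,R)] ≥ c/R^{1/3}`, `φ_{ℤ²}[A_{1010}(1,R)] ≥ c/R^{4/3}`.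
While the result of [PonIkh] is sharp, the bound we obtain are not"; and §1.4: "For `1 ≤ q ≤ 2`,
the one-arm, two-arm and four-arm exponents can be rigorously bounded from above by `1/4`, `1/2`
and `3/2`, respectively [...]. For Bernoulli percolation, these bounds can be further improved to
`1/6`, `1/3`, and `4/3` (to be compared with the conjectured values `5/48`, `1/4`, and `5/4`)."
Setting (ibid. §1.2, (1.6), §6): `φ_{ℤ²}` is the infinite-volume random-cluster measure at
`p_c(q) = √q/(1+√q)`, at `q = 1` "Bernoulli percolation", i.e. bond percolation on `ℤ²` at `1/2`;
`Λ_n` is spanned by `{-n,…,n}²`; `π₁⁺(R) := φ⁰_ℍ[0 ⟷ ∂Λ_R]` is the one-arm probability in the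
half-plane `ℍ = ℤ × ℤ₊` with free boundary conditions; "a self-avoiding path of `ℤ²` or `(ℤ²)*`
connecting the inner to the outer boundaries of the annulus [`Λ_R ∖ Λ_r`] is called an arm [...] of
type `1` if it is composed of primal edges that are all open, and of type `0` if it is composed of
dual edges that are all dual-open. For `k ≥ 1` and `σ ∈ {0,1}^k`, define `A_σ(r,R)` to be the event
that there exist `k` disjoint arms from `∂Λ_r` to `∂Λ_R` which are of type `σ₁,…,σ_k`"; so
`A_{10}(0,R)` is the polychromatic two-arm event from the origin to distance `R`.

The input for `q = 1`. Y. Ikhlef, A. K. Ponsaing, *Finite-size left-passage probability in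
percolation*, J. Stat. Phys. 149 (2012) 10–36 (arXiv 1202.5476) [IkhlefPonsaing2012] (held text
`paper:arxiv-1202.5476`): for critical bond percolation realised as the Temperley–Lieb loop model
with `n = 1` on a strip of odd width `L` (one side wired, the other free, §2.2), with `P_b^{(L)}`
"the probability that this infinite path [the hull `γ`] passes through the first site at a given
vertical position" (§4), **Prop. 4.7**: `P_b^{(L)} = A_V(L) A_V(L+2) / N_8(L+1)²` (numbers of
vertically symmetric alternating sign matrices and of cyclically symmetric self-complementary plane
partitions; from the `q`KZ solution for the transfer-matrix ground state, §3), and **Prop. 4.9**: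
"In the limit `L → ∞`, [...] `P_b^{(L)} ∼ C L^{-1/3}`, `P̂_b^{(L)} ∼ Ĉ L^{-1/3}`" with
`C = 9·2^{-5/3} Γ(1/3)Γ(5/6) / (Γ(1/6)Γ(2/3))`.

SCOPE NOTE (provenance, stated for the refuter; nothing here is asserted by the fact). Prop. 6.10
is proved in DMT 2021. The step "`π₁⁺(R) R^{1/3}` bounded away from `0` and `∞`" is attributed
there to [PonIkh], whose printed theorems are the strip statements Prop. 4.7–4.9 above; the
comparison of the strip boundary-passage probability `P_b^{(L)}` with the half-plane one-arm
probability `π₁⁺` of (1.6) up to multiplicative constants is asserted in DMT §6.4 (and again in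
W. Zhou, arXiv 2409.03235, §1.4 (10): "`c₀⁻¹ R^{-1/3} ≤ P(A₁⁺(0,R)) ≤ c₀ R^{-1/3}` [...] is derived
in [IkPon12]") and is not itself printed with a proof. The fact below is vendored at exactly the
strength DMT print for the two-arm event (second line of the `q = 1` display), as a HYPOTHESIS
for routes (requested as `TwoArmThird` by the forward ladder on `CardyFormulaZ2`); DMT's
unconditional companion for `1 ≤ q ≤ 2` is `φ[A_{10}(0,R)] ≥ c/R^{1/2}` (Prop. 6.10 with
Prop. 6.11, `π₁⁺(R) ≥ c₁₅ R^{-1/2}`), which the fact implies eventually and which is not vendored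
separately.

RENDERING (the dictionary of `FourArmGarban.lean` / `FourArmGarbanTwoArms.lean`). At `q = 1` an
open arm from the origin to `∂Λ_R` together with a disjoint dual-open arm from the dual boundary of
`Λ_0` to that of `Λ_R` gives, inside the annulus `A_{3,R'}` for `R' = R - O(1)` (dual-boundary
conventions), an open crossing from `‖·‖_∞ = 3` to `‖·‖_∞ = R'` and NO open circuit of `A_{3,R'}`
around the origin (a dual-open arm from inside `Λ_3` to outside `Λ_{R'}` crosses every such
circuit: the tree's `not_mem_openCircuitInAnnulus_of_dualWalk`, `openDualArmsAt_zero_subset`), i.e.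
`A_{10}(0,R) ⊆ twoArmOpenDual 3 R'`; so the printed `φ[A_{10}(0,R)] ≥ c R^{-1/3}` yields the same
power law for `P_{1/2}(twoArmOpenDual 3 n)`, the bounded shift of radii and the finitely many small
`n` being absorbed by the constant and by "eventually" (`∀ᶠ n in atTop`, the requester's form; the
printed statement is for all `R ≥ 1` with DMT's convention `r_σ` on small inner radii). Inner radius
`3` is the requester's choice; every inner radius `m ≥ 3` follows (`of_le`, by
`real_twoArmOpenDual_mono`).

Deliberately NOT here: the one-arm (`≥ c R^{-1/6}`) and four-arm (`≥ c R^{-4/3}`) lines of the same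
display, the `q > 1` statements, the half-plane one-arm asymptotics itself (it needs the half-plane
measure and is the unprinted comparison above), upper bounds on `π₂`.

## References

* H. Duminil-Copin, I. Manolescu, V. Tassion, Probab. Theory Related Fields 181 (2021), §6.4,
  Prop. 6.10 and the display for `q = 1` following its proof; §1.4 [DuminilCopinManolescuTassion2021].
* Y. Ikhlef, A. K. Ponsaing, J. Stat. Phys. 149 (2012), Prop. 4.7, Prop. 4.9 [IkhlefPonsaing2012].

Tree: `twoArmOpenDual` (`FourArmGarban.lean`), `real_twoArmOpenDual_mono`
(`FourArmGarbanMonotone.lean`), `bondPercolation`, `half` (`Percolation.lean`), `zdGraph`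
(`LatticeGraph.lean`). Mathlib: `Filter.eventually_ge_atTop`, `Asymptotics.IsBigO.of_bound`,
`le_inv_mul_iff₀`.
-/

noncomputable section

namespace Literature.Probability.Percolation

open _root_.MeasureTheory Filter LatticeModels

/-- **Two-arm exponent of critical bond percolation on `ℤ²` is at most `1/3`**
(Duminil-Copin–Manolescu–Tassion 2021, §6.4: Prop. 6.10, `φ_{ℤ²}[A_{10}(0,R)] ≥ c₁₄ π₁⁺(R)` for
`1 ≤ q < 4`, combined for `q = 1` with Ikhlef–Ponsaing 2012, Prop. 4.7/4.9, read by DMT as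
"`π₁⁺(R)R^{1/3}` is bounded away from `0` and `∞` uniformly in `R`", giving the printed
`φ_{ℤ²}[A_{10}(0,R)] ≥ c/R^{1/3}`): there is `c > 0` such that, for all large `n`,
`P_{1/2}(twoArmOpenDual 3 n) ≥ c · n^{-1/3}` — the polychromatic two-arm event (open crossing of
`A_{3,n} = {3 ≤ ‖·‖_∞ ≤ n}` and no open circuit of `A_{3,n}` around the origin, the cluster form
of "one open arm and one dual-open arm", see the module docstring for the rendering and the scope
note on the Ikhlef–Ponsaing step). The requester's `TwoArmThird`. [cite: DuminilCopinManolescuTassion2021, §6.4, Prop. 6.10 (second inequality) and the q = 1 display following its proof (second line); §1.4 (arXiv 2007.14707 numbering)] [cite: IkhlefPonsaing2012, Prop. 4.7 and Prop. 4.9 (arXiv 1202.5476 numbering)] -/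
def DuminilCopinManolescuTassion2021_zdTwoArm_third : Prop :=
  ∃ c : ℝ, 0 < c ∧ ∀ᶠ n : ℕ in atTop,
    c * (n : ℝ) ^ (-(1 : ℝ) / 3) ≤ (bondPercolation (zdGraph 2) half).real (twoArmOpenDual 3 n)

namespace DuminilCopinManolescuTassion2021_zdTwoArm_third

/-- **Any inner radius `m ≥ 3`**: the two-arm event only grows when the annulus shrinks from the
inside (`real_twoArmOpenDual_mono`), so the same power law holds for `P_{1/2}(twoArmOpenDual m n)`,
with the same constant, eventually in `n`. [cite: DuminilCopinManolescuTassion2021, §6.4, q = 1 display after Prop. 6.10 (second line)] -/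
theorem of_le (h : DuminilCopinManolescuTassion2021_zdTwoArm_third) {m : ℕ} (hm : 3 ≤ m) :
    ∃ c : ℝ, 0 < c ∧ ∀ᶠ n : ℕ in atTop,
      c * (n : ℝ) ^ (-(1 : ℝ) / 3) ≤
        (bondPercolation (zdGraph 2) half).real (twoArmOpenDual m n) := by
  obtain ⟨c, hc, h⟩ := h
  refine ⟨c, hc, ?_⟩
  filter_upwards [h, eventually_ge_atTop m] with n hn hmn
  exact hn.trans (real_twoArmOpenDual_mono half hm hmn le_rfl)

/-- **Big-O form**: `n^{-1/3} = O(P_{1/2}(twoArmOpenDual 3 n))` as `n → ∞`. [cite: DuminilCopinManolescuTassion2021, §6.4, q = 1 display after Prop. 6.10 (second line)] -/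
theorem isBigO (h : DuminilCopinManolescuTassion2021_zdTwoArm_third) :
    (fun n : ℕ => (n : ℝ) ^ (-(1 : ℝ) / 3)) =O[atTop]
      fun n : ℕ => (bondPercolation (zdGraph 2) half).real (twoArmOpenDual 3 n) := by
  obtain ⟨c, hc, h⟩ := h
  refine Asymptotics.IsBigO.of_bound c⁻¹ ?_
  filter_upwards [h] with n hn
  rw [Real.norm_of_nonneg (Real.rpow_nonneg (Nat.cast_nonneg n) _),
    Real.norm_of_nonneg measureReal_nonneg]
  exact (le_inv_mul_iff₀ hc).2 hn

end DuminilCopinManolescuTassion2021_zdTwoArm_third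

end Literature.Probability.Percolation
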